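import Summits.Ventures.HSemireg.WedgeHankelRecurrenceGaussChebyshevCosecantSumHalf
import Mathlib.Analysis.SpecialFunctions.Trigonometric.Bounds

/-!
# Venture HSemireg — **THE TWO TRIGONOMETRIC SUMS OF THE ELEMENTARY PROOF OF `ζ(2) = π²∕6`: `∑_{k=1}^{m} 1∕sin²(kπ∕(2m+1)) = 2m(m+1)∕3` and `∑_{k=1}^{m} cot²(kπ∕(2m+1)) = m(2m−1)∕3`, with
# the squeeze `m(2m−1)∕3 < ((2m+1)∕π)² ∑_{k=1}^{m} 1∕k² < 2m(m+1)∕3`** (`m ≥ 1`) — from the Chebyshev-side cosecant sum `∑_{k=1}^{n−1} 1∕(2 − 2cos(2kπ∕n)) = (n²−1)∕12` (N513) at `n = 2m+1`, folded by `k ↦ n − k`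

HONEST FRAMING. Part of the Lean index of the computation cell `pub-hsemireg` (seat p10 gen 49, Sunday typer «UNIFORM-IN-n»).  Real trigonometry and finite sums only (Mathlib `Real.sin ∕ cos ∕ cot ∕ tan`,
`Finset.sum`); no variety, no cohomology theory, no sheaf, no Ext group and no semiregularity map is constructed here; nothing here says that HC / HC_CM / HC_AV holds; no Literature fact (unproved
`Prop`) is declared or used.  Custodian versions as in `WedgeHankelSiegelIdeal` (1/3).
SOURCES (cited).  A. M. Yaglom, I. M. Yaglom, *Challenging Mathematical Problems with Elementary Solutions* II (1967), Problems 143–145; I. Papadimitriou, Amer. Math. Monthly 80 (1973) 424–425 («A simple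
proof of the formula `∑ k⁻² = π²∕6`»); T. M. Apostol, Amer. Math. Monthly 80 (1973) 425–431; M. Aigner, G. M. Ziegler, *Proofs from THE BOOK*, Ch. 9 (the cotangent-sum proof).
PROOF TYPED HERE.  N513 `sum_inv_two_sub_two_mul_cos_eq` at `n = 2m+1` and `2 − 2cos 2α = 4sin² α` give `∑_{k=1}^{2m} csc² = 4m(m+1)∕3`; split the range (`Finset.sum_range_add`), reflect the upper half (`sin(π − x) = sin x`,
`Finset.sum_range_reflect`); `cot² = csc² − 1`; the squeeze from Mathlib `Real.lt_tan` (`x < tan x`) and `Real.sin_lt` (`sin x < x`) on `(0, π∕2)`, summed with `Finset.sum_lt_sum_of_nonempty`.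
DEDUP DISCLOSURE (`rg -n 'cot_sq|inv_sin_sq|Basel|zeta_two' Summits Literature`, `lean search`, 2026-09-04): the FULL-RANGE sums are in the tree and are CITED, not restated —
`Literature.NumberTheory.ModularForms.sum_cot_sq_eq` (`∑_{k<b} cot²(πk∕b) = (b−1)(b−2)∕3`, Beck–Robins Ex. 7.11, via Dedekind sums) and
`Literature.Analysis.Quadrature.PolynomialLatticeDiscrepancy.sum_inv_sin_sq_eq` (Dick–Pillichshammer Cor. A.23); the HALF-RANGE sums at odd `b = 2m+1` below (the shape used in the `ζ(2)` proof),
the pointwise squeeze and the partial-sum squeeze are not in the tree; Mathlib proves `ζ(2) = π²∕6` (`hasSum_zeta_two`) by other means and has no finite cotangent sum; 0 hits for the 4 names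
below (`sum_cot_sq_odd_half_eq` is named apart from the Literature lemma).

WHAT IS IN THE TREE.  N513 `sum_inv_two_sub_two_mul_cos_eq`; the two Literature full-range sums (cited); Mathlib `Real.sin_pi_sub`, `Real.cot_eq_cos_div_sin`, `Real.lt_tan`, `Real.sin_lt`, `Finset.sum_range_add ∕ sum_range_reflect ∕ sum_lt_sum_of_nonempty`.
THIS FILE (namespace `Summit.Ventures.HSemireg.Wedge.HankelOuter` continued; CHAINED on N514; 0 definitions):
* §1280 **`sum_inv_sin_sq_odd_half_eq`** (`∑_{k=1}^{m} csc²(kπ∕(2m+1)) = 2m(m+1)∕3`), **`sum_cot_sq_odd_half_eq`** (`∑_{k=1}^{m} cot²(kπ∕(2m+1)) = m(2m−1)∕3`), `cot_sq_lt_inv_sq_lt_inv_sin_sq`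
  (`cot² x < 1∕x² < csc² x` on `(0, π∕2)`), **`basel_partial_sum_squeeze`** (`m(2m−1)∕3 < ((2m+1)∕π)² ∑_{k=1}^{m} k⁻² < 2m(m+1)∕3`, `m ≥ 1`).
CAVEATS.  Sums over `k ∈ [1, m]` are written over `Finset.range m` with the shift `k + 1`; the squeeze needs `m ≥ 1` (strict).  The limit `ζ(2) = π²∕6` itself is Mathlib's and is not restated.
Nothing Ext-side.  New names only.
-/

open Module Polynomial
open scoped Matrix Polynomial

namespace Summit.Ventures.HSemireg.Wedge.HankelOuter

/-! ## §1280. The cotangent sum of the elementary `ζ(2)` proof -/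

/-- **`∑_{k=1}^{m} 1∕sin²(kπ∕(2m+1)) = 2m(m+1)∕3`** (half of the symmetric sum `∑_{k=1}^{2m} = ((2m+1)² − 1)∕3`). [Yaglom–Yaglom II.145; Aigner–Ziegler Ch. 9; this file, §1280] -/
theorem sum_inv_sin_sq_odd_half_eq (m : ℕ) : ∑ k ∈ Finset.range m, 1 / Real.sin ((k + 1 : ℕ) * (Real.pi / (2 * m + 1 : ℕ))) ^ 2 = 2 * (m : ℝ) * (m + 1) / 3 := by
  have h := sum_inv_two_sub_two_mul_cos_eq (n := 2 * m + 1) (Nat.succ_ne_zero _)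
  have hterm : ∀ j ∈ Finset.range (2 * m + 1 - 1), 1 / (2 - 2 * Real.cos ((j + 1 : ℕ) * (2 * Real.pi / (2 * m + 1 : ℕ)))) =
      (1 / 4) * (1 / Real.sin ((j + 1 : ℕ) * (Real.pi / (2 * m + 1 : ℕ))) ^ 2) := fun j _ => by
    rw [show ((j + 1 : ℕ) : ℝ) * (2 * Real.pi / (2 * m + 1 : ℕ)) = 2 * (((j + 1 : ℕ) : ℝ) * (Real.pi / (2 * m + 1 : ℕ))) by ring, Real.cos_two_mul, Real.cos_sq']
    ring
  rw [Finset.sum_congr rfl hterm, ← Finset.mul_sum, show 2 * m + 1 - 1 = m + m by omega, Finset.sum_range_add] at h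
  -- the upper half equals the lower half by `k ↦ 2m + 1 − k`
  have hupper : ∑ k ∈ Finset.range m, 1 / Real.sin ((m + k + 1 : ℕ) * (Real.pi / (2 * m + 1 : ℕ))) ^ 2 =
      ∑ k ∈ Finset.range m, 1 / Real.sin ((k + 1 : ℕ) * (Real.pi / (2 * m + 1 : ℕ))) ^ 2 := by
    rw [← Finset.sum_range_reflect (fun k => 1 / Real.sin ((m + k + 1 : ℕ) * (Real.pi / (2 * m + 1 : ℕ))) ^ 2) m]
    refine Finset.sum_congr rfl fun k hk => ?_
    have hk := Finset.mem_range.mp hk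
    have hidx : (((m + (m - 1 - k) + 1 : ℕ)) : ℝ) * (Real.pi / (2 * m + 1 : ℕ)) = Real.pi - ((k + 1 : ℕ) : ℝ) * (Real.pi / (2 * m + 1 : ℕ)) := by
      rw [show m + (m - 1 - k) + 1 = 2 * m + 1 - (k + 1) by omega, Nat.cast_sub (by omega)]
      have : (((2 * m + 1 : ℕ)) : ℝ) ≠ 0 := by positivity
      field_simp
    simp only [hidx, Real.sin_pi_sub]
  rw [hupper, ← two_mul] at h
  push_cast at h ⊢
  linarith

/-- **`∑_{k=1}^{m} cot²(kπ∕(2m+1)) = m(2m−1)∕3`.** [Yaglom–Yaglom II.144; Papadimitriou 1973; Aigner–Ziegler Ch. 9; this file, §1280] -/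
theorem sum_cot_sq_odd_half_eq (m : ℕ) : ∑ k ∈ Finset.range m, Real.cot ((k + 1 : ℕ) * (Real.pi / (2 * m + 1 : ℕ))) ^ 2 = (m : ℝ) * (2 * m - 1) / 3 := by
  have h := sum_inv_sin_sq_odd_half_eq m
  have hterm : ∀ k ∈ Finset.range m, Real.cot ((k + 1 : ℕ) * (Real.pi / (2 * m + 1 : ℕ))) ^ 2 = 1 / Real.sin ((k + 1 : ℕ) * (Real.pi / (2 * m + 1 : ℕ))) ^ 2 - 1 := fun k hk => by
    have hk := Finset.mem_range.mp hk
    have hpos : 0 < ((k + 1 : ℕ) : ℝ) * (Real.pi / (2 * m + 1 : ℕ)) := by positivity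
    have hlt : ((k + 1 : ℕ) : ℝ) * (Real.pi / (2 * m + 1 : ℕ)) < Real.pi := by
      rw [mul_div_assoc', div_lt_iff₀ (by positivity)]
      have : ((k + 1 : ℕ) : ℝ) < ((2 * m + 1 : ℕ) : ℝ) := by exact_mod_cast (by omega : k + 1 < 2 * m + 1)
      nlinarith [Real.pi_pos]
    have hsin : Real.sin (((k + 1 : ℕ) : ℝ) * (Real.pi / (2 * m + 1 : ℕ))) ≠ 0 := (Real.sin_pos_of_pos_of_lt_pi hpos hlt).ne'
    rw [Real.cot_eq_cos_div_sin, div_pow, Real.cos_sq', sub_div, div_self (pow_ne_zero 2 hsin), one_div]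
  rw [Finset.sum_congr rfl hterm, Finset.sum_sub_distrib, h, Finset.sum_const, Finset.card_range, nsmul_eq_mul, mul_one]
  ring

/-- On `(0, π∕2)`: **`cot² x < 1∕x² < 1∕sin² x`** (from `sin x < x < tan x`). [Aigner–Ziegler Ch. 9; this file, §1280] -/
theorem cot_sq_lt_inv_sq_lt_inv_sin_sq {x : ℝ} (h0 : 0 < x) (hx : x < Real.pi / 2) : Real.cot x ^ 2 < 1 / x ^ 2 ∧ 1 / x ^ 2 < 1 / Real.sin x ^ 2 := by
  have hsin : 0 < Real.sin x := Real.sin_pos_of_pos_of_lt_pi h0 (hx.trans (by linarith [Real.pi_pos]))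
  have htan : 0 < Real.tan x := Real.tan_pos_of_pos_of_lt_pi_div_two h0 hx
  have hcot : Real.cot x = 1 / Real.tan x := by
    rw [Real.cot_eq_cos_div_sin, Real.tan_eq_sin_div_cos, one_div, inv_div]
  constructor
  · rw [hcot, div_pow, one_pow]
    exact one_div_lt_one_div_of_lt (pow_pos h0 2) (pow_lt_pow_left₀ (Real.lt_tan h0 hx) h0.le two_ne_zero)
  · exact one_div_lt_one_div_of_lt (pow_pos hsin 2) (pow_lt_pow_left₀ (Real.sin_lt h0) hsin.le two_ne_zero)

/-- **THE BASEL SQUEEZE: `m(2m−1)∕3 < ((2m+1)∕π)² ∑_{k=1}^{m} 1∕k² < 2m(m+1)∕3`** (`m ≥ 1`; letting `m → ∞` gives `∑ 1∕k² = π²∕6`, which is Mathlib's `hasSum_zeta_two` and is not restated). [Papadimitriou 1973;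
Apostol 1973; Aigner–Ziegler Ch. 9; this file, §1280] -/
theorem basel_partial_sum_squeeze {m : ℕ} (hm : 0 < m) :
    (m : ℝ) * (2 * m - 1) / 3 < ((2 * m + 1 : ℕ) / Real.pi) ^ 2 * ∑ k ∈ Finset.range m, 1 / ((k + 1 : ℕ) : ℝ) ^ 2 ∧
      ((2 * m + 1 : ℕ) / Real.pi) ^ 2 * ∑ k ∈ Finset.range m, 1 / ((k + 1 : ℕ) : ℝ) ^ 2 < 2 * (m : ℝ) * (m + 1) / 3 := by
  have hne : (Finset.range m).Nonempty := Finset.nonempty_range_iff.mpr hm.ne'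
  have hmem : ∀ k ∈ Finset.range m, 0 < ((k + 1 : ℕ) : ℝ) * (Real.pi / (2 * m + 1 : ℕ)) ∧ ((k + 1 : ℕ) : ℝ) * (Real.pi / (2 * m + 1 : ℕ)) < Real.pi / 2 := fun k hk => by
    have hk := Finset.mem_range.mp hk
    refine ⟨by positivity, ?_⟩
    rw [mul_div_assoc', div_lt_div_iff₀ (by positivity) two_pos]
    have : ((k + 1 : ℕ) : ℝ) * 2 < ((2 * m + 1 : ℕ) : ℝ) := by exact_mod_cast (by omega : (k + 1) * 2 < 2 * m + 1)
    nlinarith [Real.pi_pos]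
  -- `1/x_k² = ((2m+1)/π)² / (k+1)²`
  have hinv : ∀ k : ℕ, 1 / (((k + 1 : ℕ) : ℝ) * (Real.pi / (2 * m + 1 : ℕ))) ^ 2 = ((2 * m + 1 : ℕ) / Real.pi) ^ 2 * (1 / ((k + 1 : ℕ) : ℝ) ^ 2) := fun k => by
    have hπ : Real.pi ≠ 0 := Real.pi_ne_zero
    have hk : ((k + 1 : ℕ) : ℝ) ≠ 0 := by positivity
    have hm' : (((2 * m + 1 : ℕ)) : ℝ) ≠ 0 := by positivity
    field_simp
  have hmid : ((2 * m + 1 : ℕ) / Real.pi) ^ 2 * ∑ k ∈ Finset.range m, 1 / ((k + 1 : ℕ) : ℝ) ^ 2 = ∑ k ∈ Finset.range m, 1 / (((k + 1 : ℕ) : ℝ) * (Real.pi / (2 * m + 1 : ℕ))) ^ 2 := by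
    rw [Finset.mul_sum]; exact Finset.sum_congr rfl fun k _ => (hinv k).symm
  rw [hmid, ← sum_cot_sq_odd_half_eq m, ← sum_inv_sin_sq_odd_half_eq m]
  exact ⟨Finset.sum_lt_sum_of_nonempty hne fun k hk => (cot_sq_lt_inv_sq_lt_inv_sin_sq (hmem k hk).1 (hmem k hk).2).1,
    Finset.sum_lt_sum_of_nonempty hne fun k hk => (cot_sq_lt_inv_sq_lt_inv_sin_sq (hmem k hk).1 (hmem k hk).2).2⟩

end Summit.Ventures.HSemireg.Wedge.HankelOuter
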